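import Summits.AtomisticToContinuum.HydrodynamicLimit.Theses.CollisionIsometryCLT

/-!
# `DiffuseBackwardInfluence`: idle rows, the planar-normal kernel, and the involutive fold step
(negative knowledge / load-bearing analysis for crux stmt-AtomisticToContinuum-12950)

From the standing disprover's `Cruxes/DiffuseBackwardInfluence/Disproof.lean`
(refuter-cdisprove-stmt-AtomisticToContinuum-12950-0). The crux's `let M` (frozen-geometry velocity transfer)
and `let ipr` are restated as the definitions `transfer`/`ipr` below (definitionally: `fewIdle_of_…` consumes the
crux BY NAME through `change`). Proved here:

* rows of particles that belong to no colliding pair of the window are untouched (`transfer_apply_of_idle`,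
  `rowIpr_of_idle`), hence pointwise `ipr ≥ 9 × idle fraction` (`nine_mul_idleFrac_le_ipr`) and
  `ipr = 9` when the window carries no collision (`ipr_eq_nine_of_colls_eq_zero`); consequently the crux IMPLIES
  FewCollisionsRare at `m = 0` in mean (`fewIdle_of_diffuseBackwardInfluence`: the local-Gibbs-evolved expected
  idle fraction tends to `0` on every admissible window) — a NECESSARY condition every proof must establish and a
  refutation handle (an admissible window with non-vanishing expected idle fraction kills the crux);
* the fold step is an involution (`step_step`): no functional of the transfer is pathwise monotone along arbitrary
  reflection sequences (Loschmidt echo) — delocalisation must come from the law of the realised sequence;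
* if every realised normal of the window is orthogonal to a coordinate direction, the corresponding velocity
  components are invariants and every row keeps participation `≥ 1` (`one_le_rowIpr_of_planar`,
  `one_le_ipr_of_planar`): `n_N → ∞` collisions per particle do NOT imply delocalisation without 3-D
  non-degeneracy of the realised normals (the pointwise strengthening "ipr_i ≤ f(#own collisions) → 0" is false).
-/

namespace Summit.AtomisticToContinuum.HydrodynamicLimit.Theorems.DiffuseBackwardInfluenceNeg

open scoped BigOperators Topology ENNReal InnerProductSpace
open Filter Set MeasureTheory
open Literature.Analysis.FluidPDE Literature.MathematicalPhysics.KineticTheory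
open Summit.AtomisticToContinuum.HydrodynamicLimit.Theses.CollisionIsometryCLT

noncomputable section

/-- Velocity space `ℝ³`. -/
abbrev V3 : Type := EuclideanSpace ℝ (Fin 3)
/-- Position space `𝕋³`. -/
abbrev T3 : Type := UnitAddTorus (Fin 3)
/-- Phase space of `N + 1` spheres on `𝕋³`. -/
abbrev Cfg (N : ℕ) : Type := Config (N + 1) (Fin 3) T3

/-! ## §1 The crux's `let`s as definitions -/

section Transfer

variable (σ : ℝ) (N : ℕ)

/-- The pre-collisional configuration of the `k`-th fold step (the crux's `pre k`). -/
def pre (y : Cfg N) (k : ℕ) : Cfg N :=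
  let G := Torus.geometry (Fin 3)
  let ε : ℝ := hsDiameter σ N
  let zk := Alexander.stateAfter G ε y k
  freeFlight G (Alexander.freeExitTime G ε zk).toReal zk

/-- The incoming contact pairs seen by the `k`-th fold step. -/
def pairsAt (y : Cfg N) (k : ℕ) : Set (Fin (N + 1) × Fin (N + 1)) :=
  Alexander.incomingPairs (Torus.geometry (Fin 3)) (hsDiameter σ N) (pre σ N y k)

/-- One fold step of the crux's transfer: the velocity part of `collidePair` of the chosen incoming
pair at the positions of `pre k`, applied to the velocity field `W'` (identity if no incoming pair). -/
def step (y : Cfg N) (W' : Fin (N + 1) → V3) (k : ℕ) : Fin (N + 1) → V3 :=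
  @dite (Fin (N + 1) → V3) (pairsAt σ N y k).Nonempty (Classical.propDecidable _)
    (fun h => fun i =>
      (collidePair (Torus.geometry (Fin 3)) h.some.1 h.some.2
        (fun j => ((pre σ N y k j).1, W' j)) i).2)
    (fun _ => W')

/-- The number of fold steps: collisions of the Alexander construction from `y` in `[0, Δ]`. -/
def colls (y : Cfg N) (Δ : ℝ) : ℕ :=
  Alexander.collisionCount (Torus.geometry (Fin 3)) (hsDiameter σ N) y Δ

/-- The frozen-geometry velocity transfer over `[0, Δ]` (the crux's `M N y Δ`). -/
def transfer (y : Cfg N) (Δ : ℝ) (W : Fin (N + 1) → V3) : Fin (N + 1) → V3 :=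
  (List.range (colls σ N y Δ)).foldl (step σ N y) W

/-- Row participation of particle `i`: `Σ_k ‖M_ik‖_F⁴ = Σ_k (Σ_a ‖M (e_k ⊗ e_a) i‖²)²`. -/
def rowIpr (y : Cfg N) (Δ : ℝ) (i : Fin (N + 1)) : ℝ :=
  ∑ k : Fin (N + 1),
    (∑ a : Fin 3, ‖transfer σ N y Δ (Pi.single k (EuclideanSpace.single a (1 : ℝ))) i‖ ^ 2) ^ 2

/-- The mean inverse participation ratio (the crux's `ipr N y Δ`). -/
def ipr (y : Cfg N) (Δ : ℝ) : ℝ :=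
  ((N + 1 : ℕ) : ℝ)⁻¹ * ∑ i : Fin (N + 1), rowIpr σ N y Δ i

end Transfer

/-! ## §2 Idle rows are untouched: FewCollisionsRare (m = 0) is NECESSARY -/

section Idle

variable {σ : ℝ} {N : ℕ}

/-- The *idle set* of the window `[0, Δ]`: particles that are an endpoint of none of the fold's colliding
pairs (stated through `h.some`, the very pair the fold reflects). -/
def idleSet (σ : ℝ) (N : ℕ) (y : Cfg N) (Δ : ℝ) : Set (Fin (N + 1)) :=
  {i | ∀ k < colls σ N y Δ, ∀ h : (pairsAt σ N y k).Nonempty, i ≠ h.some.1 ∧ i ≠ h.some.2}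

/-- Membership in the idle set, unfolded. [folklore] -/
theorem mem_idleSet {σ : ℝ} {N : ℕ} {y : Cfg N} {Δ : ℝ} {i : Fin (N + 1)} :
    i ∈ idleSet σ N y Δ ↔
      ∀ k < colls σ N y Δ, ∀ h : (pairsAt σ N y k).Nonempty, i ≠ h.some.1 ∧ i ≠ h.some.2 :=
  Iff.rfl

/-- A fold step does not touch the velocity of a particle outside the reflected pair. [folklore] -/
theorem step_apply_of_ne {y : Cfg N} {k : ℕ} {i : Fin (N + 1)}
    (hi : ∀ h : (pairsAt σ N y k).Nonempty, i ≠ h.some.1 ∧ i ≠ h.some.2)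
    (W : Fin (N + 1) → V3) : step σ N y W k i = W i := by
  unfold step
  by_cases h : (pairsAt σ N y k).Nonempty
  · rw [dif_pos h, collidePair_apply_of_ne (hi h).1 (hi h).2]
  · rw [dif_neg h]

/-- Folding steps that never touch `i` leaves `W i` unchanged. [folklore] -/
theorem foldl_step_apply {y : Cfg N} {i : Fin (N + 1)} (L : List ℕ)
    (hL : ∀ k ∈ L, ∀ h : (pairsAt σ N y k).Nonempty, i ≠ h.some.1 ∧ i ≠ h.some.2)
    (W : Fin (N + 1) → V3) : (L.foldl (step σ N y) W) i = W i := by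
  induction L generalizing W with
  | nil => rfl
  | cons k L ih =>
    rw [List.foldl_cons, ih (fun k' hk' => hL k' (List.mem_cons_of_mem _ hk')),
      step_apply_of_ne (hL k List.mem_cons_self)]

/-- **Rows of idle particles are untouched by the transfer.** [folklore] -/
theorem transfer_apply_of_idle {y : Cfg N} {Δ : ℝ} {i : Fin (N + 1)} (hi : i ∈ idleSet σ N y Δ)
    (W : Fin (N + 1) → V3) : transfer σ N y Δ W i = W i :=
  foldl_step_apply _ (fun k hk => (mem_idleSet.1 hi) k (List.mem_range.1 hk)) W

/-- The participation of a fresh (identity) row is `9`. [folklore] -/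
theorem sum_single_norm_sq_sq (i : Fin (N + 1)) :
    ∑ k : Fin (N + 1), (∑ a : Fin 3,
      ‖(Pi.single k (EuclideanSpace.single a (1 : ℝ)) : Fin (N + 1) → V3) i‖ ^ 2) ^ 2 = 9 := by
  have hk : ∀ k : Fin (N + 1), (∑ a : Fin 3,
      ‖(Pi.single k (EuclideanSpace.single a (1 : ℝ)) : Fin (N + 1) → V3) i‖ ^ 2) ^ 2 =
      if i = k then 9 else 0 := by
    intro k
    by_cases hik : i = k
    · subst hik
      simp only [Pi.single_eq_same, if_true]
      have h1 : ∀ a : Fin 3, ‖(EuclideanSpace.single a (1 : ℝ) : V3)‖ ^ 2 = 1 := fun a => by simp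
      simp only [h1, Finset.sum_const, Finset.card_univ, Fintype.card_fin, nsmul_eq_mul, mul_one]
      norm_num
    · simp [hik]
  simp_rw [hk]
  simp

/-- **An idle row has participation exactly `9`.** [folklore] -/
theorem rowIpr_of_idle {y : Cfg N} {Δ : ℝ} {i : Fin (N + 1)} (hi : i ∈ idleSet σ N y Δ) :
    rowIpr σ N y Δ i = 9 := by
  unfold rowIpr
  simp_rw [transfer_apply_of_idle hi]
  exact sum_single_norm_sq_sq i

/-- Row participations are nonnegative. [folklore] -/
theorem rowIpr_nonneg (σ : ℝ) (N : ℕ) (y : Cfg N) (Δ : ℝ) (i : Fin (N + 1)) :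
    0 ≤ rowIpr σ N y Δ i :=
  Finset.sum_nonneg fun k _ => by positivity

/-- With no collision in the window the transfer is the identity and `ipr = 9` (in particular on the
Liouville-null junk sets where `collisionCount` returns `0`: Zeno orbits, overlapping data). [folklore] -/
theorem ipr_eq_nine_of_colls_eq_zero {y : Cfg N} {Δ : ℝ} (h0 : colls σ N y Δ = 0) :
    ipr σ N y Δ = 9 := by
  have hidle : ∀ i, i ∈ idleSet σ N y Δ := fun i =>
    mem_idleSet.2 fun k hk => absurd hk (by rw [h0]; exact Nat.not_lt_zero k)
  unfold ipr
  simp_rw [rowIpr_of_idle (hidle _)]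
  simp only [Finset.sum_const, Finset.card_univ, Fintype.card_fin, nsmul_eq_mul]
  have hN : ((N + 1 : ℕ) : ℝ) ≠ 0 := by positivity
  field_simp

/-- The number of idle particles of the window (`Nat.card`, no decidability baked in). -/
def idleCount (σ : ℝ) (N : ℕ) (y : Cfg N) (Δ : ℝ) : ℕ :=
  Nat.card (idleSet σ N y Δ)

/-- `9 × #idle ≤ Σ_i rowIpr_i` (idle rows contribute `9`, the others are nonnegative). [folklore] -/
theorem nine_mul_idleCount_le (σ : ℝ) (N : ℕ) (y : Cfg N) (Δ : ℝ) :
    9 * (idleCount σ N y Δ : ℝ) ≤ ∑ i : Fin (N + 1), rowIpr σ N y Δ i := by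
  classical
  have hcount : idleCount σ N y Δ = (Finset.univ.filter fun i => i ∈ idleSet σ N y Δ).card := by
    unfold idleCount
    rw [Nat.card_eq_fintype_card, ← Fintype.card_subtype]
  rw [hcount]
  calc 9 * ((Finset.univ.filter fun i => i ∈ idleSet σ N y Δ).card : ℝ)
        = ∑ i ∈ Finset.univ.filter (fun i => i ∈ idleSet σ N y Δ), (9 : ℝ) := by
          rw [Finset.sum_const, nsmul_eq_mul, mul_comm]
    _ = ∑ i ∈ Finset.univ.filter (fun i => i ∈ idleSet σ N y Δ), rowIpr σ N y Δ i :=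
          Finset.sum_congr rfl fun i hi => (rowIpr_of_idle (Finset.mem_filter.1 hi).2).symm
    _ ≤ ∑ i, rowIpr σ N y Δ i :=
          Finset.sum_le_sum_of_subset_of_nonneg (Finset.filter_subset _ _)
            fun i _ _ => rowIpr_nonneg σ N y Δ i

/-- The idle fraction `#idle / (N+1) ∈ [0, 1]`. -/
def idleFrac (σ : ℝ) (N : ℕ) (y : Cfg N) (Δ : ℝ) : ℝ :=
  (idleCount σ N y Δ : ℝ) / ((N + 1 : ℕ) : ℝ)

/-- **`ipr ≥ 9 × (idle fraction)`.** [folklore] -/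
theorem nine_mul_idleFrac_le_ipr (σ : ℝ) (N : ℕ) (y : Cfg N) (Δ : ℝ) :
    9 * idleFrac σ N y Δ ≤ ipr σ N y Δ := by
  unfold idleFrac ipr
  have hN : (0 : ℝ) < ((N + 1 : ℕ) : ℝ) := by positivity
  rw [div_eq_mul_inv, mul_comm (idleCount σ N y Δ : ℝ), ← mul_assoc, mul_comm (9 : ℝ), mul_assoc]
  exact mul_le_mul_of_nonneg_left (nine_mul_idleCount_le σ N y Δ) (inv_nonneg.2 hN.le)

end Idle

/-- FewCollisionsRare at `m = 0`, in mean: along every admissible window the local-Gibbs-evolved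
expected idle fraction tends to `0`. -/
def FewIdle : Prop :=
  ∀ (a₀ θ₀ : T3 → ℝ) (u₀ : T3 → V3), Continuous a₀ → Continuous θ₀ → Continuous u₀ →
    (∀ x, 0 < a₀ x) → (∀ x, 0 < θ₀ x) →
    ∃ σ₀ : ℝ, 0 < σ₀ ∧ ∀ σ : ℝ, 0 < σ → σ < σ₀ →
      ∀ Φ : (N : ℕ) → HardSphereFlow (Torus.geometry (Fin 3)) (hsDiameter σ N) (N + 1),
      ∀ Δ : ℕ → ℝ, (∀ N, 0 < Δ N) → Tendsto Δ atTop (𝓝 0) →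
        Tendsto (fun N : ℕ => Δ N * ((N + 1 : ℕ) : ℝ) ^ ((1 : ℝ) / 3)) atTop atTop →
        ∀ t : ℝ, 0 < t →
          Tendsto (fun N : ℕ => ∫⁻ z, ENNReal.ofReal (idleFrac σ N ((Φ N).flow (t - Δ N) z) (Δ N))
            ∂(localGibbsLaw σ a₀ u₀ θ₀ N (Φ N))) atTop (𝓝 0)

/-- **the crux implies FewCollisionsRare (m = 0) in mean** — any proof of the crux proves,
in particular, that the expected fraction of collision-free particles vanishes on every admissible window,
uniformly along the non-equilibrium law; conversely an admissible window with a non-vanishing expected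
idle fraction refutes the crux. [folklore] -/
theorem fewIdle_of_diffuseBackwardInfluence (h : DiffuseBackwardInfluence) : FewIdle := by
  change (∀ (a₀ θ₀ : T3 → ℝ) (u₀ : T3 → V3), Continuous a₀ → Continuous θ₀ → Continuous u₀ →
        (∀ x, 0 < a₀ x) → (∀ x, 0 < θ₀ x) →
        ∃ σ₀ : ℝ, 0 < σ₀ ∧ ∀ σ : ℝ, 0 < σ → σ < σ₀ →
          ∀ Φ : (N : ℕ) → HardSphereFlow (Torus.geometry (Fin 3)) (hsDiameter σ N) (N + 1),
          ∀ Δ : ℕ → ℝ, (∀ N, 0 < Δ N) → Tendsto Δ atTop (𝓝 0) →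
            Tendsto (fun N : ℕ => Δ N * ((N + 1 : ℕ) : ℝ) ^ ((1 : ℝ) / 3)) atTop atTop →
            ∀ t : ℝ, 0 < t →
              Tendsto (fun N : ℕ => ∫⁻ z, ENNReal.ofReal (ipr σ N ((Φ N).flow (t - Δ N) z) (Δ N))
                ∂(localGibbsLaw σ a₀ u₀ θ₀ N (Φ N))) atTop (𝓝 0)) at h
  intro a₀ θ₀ u₀ ha hθ hu ha0 hθ0
  obtain ⟨σ₀, hσ₀, hσ⟩ := h a₀ θ₀ u₀ ha hθ hu ha0 hθ0
  refine ⟨σ₀, hσ₀, fun σ hσp hσlt Φ Δ hΔp hΔ0 hΔg t ht => ?_⟩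
  have hipr := hσ σ hσp hσlt Φ Δ hΔp hΔ0 hΔg t ht
  set I : ℕ → ℝ≥0∞ := fun N => ∫⁻ z, ENNReal.ofReal (idleFrac σ N ((Φ N).flow (t - Δ N) z) (Δ N))
      ∂(localGibbsLaw σ a₀ u₀ θ₀ N (Φ N)) with hIdef
  have hle : ∀ N, 9 * I N ≤
      ∫⁻ z, ENNReal.ofReal (ipr σ N ((Φ N).flow (t - Δ N) z) (Δ N))
        ∂(localGibbsLaw σ a₀ u₀ θ₀ N (Φ N)) := by
    intro N
    simp only [hIdef]
    rw [← lintegral_const_mul' _ _ (by norm_num : (9 : ℝ≥0∞) ≠ ∞)]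
    refine lintegral_mono fun z => ?_
    rw [show (9 : ℝ≥0∞) = ENNReal.ofReal 9 by norm_num, ← ENNReal.ofReal_mul (by norm_num)]
    exact ENNReal.ofReal_le_ofReal (nine_mul_idleFrac_le_ipr _ _ _ _)
  have h9 : Tendsto (fun N => 9 * I N) atTop (𝓝 0) :=
    tendsto_of_tendsto_of_tendsto_of_le_of_le tendsto_const_nhds hipr (fun N => zero_le) hle
  have h91 : Tendsto (fun N => 9⁻¹ * (9 * I N)) atTop (𝓝 (9⁻¹ * 0)) :=
    ENNReal.Tendsto.const_mul h9 (Or.inr (ENNReal.inv_ne_top.2 (by norm_num : (9 : ℝ≥0∞) ≠ 0)))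
  rw [mul_zero] at h91
  refine h91.congr fun N => ?_
  rw [← mul_assoc, ENNReal.inv_mul_cancel (by norm_num) (by norm_num), one_mul]

/-! ## §3 The fold step is an involution: no pathwise monotone functional -/

section Echo

variable {σ : ℝ} {N : ℕ}

/-- **the crux's fold step is an involution.** Reflecting the same pair at the same
pre-collisional snapshot twice restores every velocity: `step k ∘ step k = id`. Hence no functional of the
transfer (in particular no row participation) is monotone along arbitrary reflection sequences — the
Loschmidt echo `R_1⋯R_L R_L⋯R_1 = I` in its shortest form. Delocalisation must come from the law of the
realised sequence, not from reflection algebra. [folklore] -/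
theorem step_step (y : Cfg N) (W : Fin (N + 1) → V3) (k : ℕ) :
    step σ N y (step σ N y W k) k = W := by
  unfold step
  by_cases h : (pairsAt σ N y k).Nonempty
  · rw [dif_pos h, dif_pos h]
    have hne : h.some.1 ≠ h.some.2 := ne_of_lt (Alexander.mem_incomingPairs.1 h.some_mem).1
    set z : Cfg N := fun j => ((pre σ N y k j).1, W j) with hz
    have hcfg : (fun j => ((pre σ N y k j).1,
        (collidePair (Torus.geometry (Fin 3)) h.some.1 h.some.2 z j).2)) =
        collidePair (Torus.geometry (Fin 3)) h.some.1 h.some.2 z := by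
      funext j
      have h1 : (collidePair (Torus.geometry (Fin 3)) h.some.1 h.some.2 z j).1 = (pre σ N y k j).1 := by
        rw [collidePair_apply_fst]
      rw [← h1]
    funext i
    rw [hcfg, collidePair_collidePair hne]
  · rw [dif_neg h, dif_neg h]

end Echo

/-! ## §4 Planar realised normals: a conserved component, `ipr ≥ 1` for ever -/

section Planar

variable {σ : ℝ} {N : ℕ}

/-- The realised (unnormalised, minimal-image) normal of the `k`-th fold step (`0` if the step reflects
nothing). -/
def normalAt (σ : ℝ) (N : ℕ) (y : Cfg N) (k : ℕ) : V3 :=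
  @dite V3 (pairsAt σ N y k).Nonempty (Classical.propDecidable _)
    (fun h => (Torus.geometry (Fin 3)).sepVec (pre σ N y k h.some.1).1 (pre σ N y k h.some.2).1)
    (fun _ => 0)

/-- A reflection at a normal orthogonal to `e` preserves every `e`-component. [folklore] -/
theorem inner_reflectVel_of_orth {n e : V3} (hn : ⟪n, e⟫_ℝ = 0) (v w : V3) :
    ⟪(reflectVel n (v, w)).1, e⟫_ℝ = ⟪v, e⟫_ℝ ∧ ⟪(reflectVel n (v, w)).2, e⟫_ℝ = ⟪w, e⟫_ℝ := by
  simp [reflectVel, inner_sub_left, inner_add_left, inner_smul_left, hn]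

/-- A fold step whose realised normal is orthogonal to `e` preserves every particle's `e`-component. [folklore] -/
theorem inner_step_of_orth {y : Cfg N} {k : ℕ} {e : V3} (hk : ⟪normalAt σ N y k, e⟫_ℝ = 0)
    (W : Fin (N + 1) → V3) (i : Fin (N + 1)) : ⟪step σ N y W k i, e⟫_ℝ = ⟪W i, e⟫_ℝ := by
  unfold step
  by_cases h : (pairsAt σ N y k).Nonempty
  · rw [dif_pos h]
    have hn : ⟪(Torus.geometry (Fin 3)).sepVec (pre σ N y k h.some.1).1 (pre σ N y k h.some.2).1,
        e⟫_ℝ = 0 := by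
      simpa [normalAt, dif_pos h] using hk
    have hne : h.some.1 ≠ h.some.2 := ne_of_lt (Alexander.mem_incomingPairs.1 h.some_mem).1
    by_cases hi1 : i = h.some.1
    · rw [hi1, collidePair_apply_left hne]
      exact (inner_reflectVel_of_orth hn _ _).1
    by_cases hi2 : i = h.some.2
    · rw [hi2, collidePair_apply_right]
      exact (inner_reflectVel_of_orth hn _ _).2
    rw [collidePair_apply_of_ne hi1 hi2]
  · rw [dif_neg h]

/-- **on a planar window the `e`-components of all velocities are invariants of the
transfer.** [folklore] -/
theorem inner_transfer_of_planar {y : Cfg N} {Δ : ℝ} {e : V3} (hP : ∀ k < colls σ N y Δ, ⟪normalAt σ N y k, e⟫_ℝ = 0)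
    (W : Fin (N + 1) → V3) (i : Fin (N + 1)) : ⟪transfer σ N y Δ W i, e⟫_ℝ = ⟪W i, e⟫_ℝ := by
  unfold transfer
  have key : ∀ L : List ℕ, (∀ k ∈ L, ⟪normalAt σ N y k, e⟫_ℝ = 0) → ∀ W : Fin (N + 1) → V3,
      ⟪(L.foldl (step σ N y) W) i, e⟫_ℝ = ⟪W i, e⟫_ℝ := by
    intro L hL
    induction L with
    | nil => intro W; rfl
    | cons k L ih =>
      intro W
      rw [List.foldl_cons, ih (fun k' hk' => hL k' (List.mem_cons_of_mem _ hk')),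
        inner_step_of_orth (hL k List.mem_cons_self)]
  exact key _ (fun k hk => hP k (List.mem_range.1 hk)) W

/-- **on a window whose realised normals are all orthogonal to the coordinate direction
`e_c`, EVERY row keeps participation `≥ 1`** — however many collisions the window carries. So
"`n_N → ∞` collisions per particle" does not imply delocalisation without non-degeneracy (3-D spread) of the
realised normals: the pointwise strengthening `ipr_i ≤ f(#own collisions) → 0` is false. [folklore] -/
theorem one_le_rowIpr_of_planar {y : Cfg N} {Δ : ℝ} (c : Fin 3)
    (hP : ∀ k < colls σ N y Δ, ⟪normalAt σ N y k, (EuclideanSpace.single c (1 : ℝ) : V3)⟫_ℝ = 0) (i : Fin (N + 1)) :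
    1 ≤ rowIpr σ N y Δ i := by
  -- the (k, a) = (i, c) entry alone is ≥ 1: its `e_c`-component is conserved and equals 1
  have hnorm_e : ‖(EuclideanSpace.single c (1 : ℝ) : V3)‖ = 1 := by simp
  have hentry : 1 ≤ ‖transfer σ N y Δ (Pi.single i (EuclideanSpace.single c (1 : ℝ))) i‖ ^ 2 := by
    have hinner : ⟪transfer σ N y Δ (Pi.single i (EuclideanSpace.single c (1 : ℝ))) i,
        (EuclideanSpace.single c (1 : ℝ) : V3)⟫_ℝ = 1 := by
      rw [inner_transfer_of_planar hP, Pi.single_eq_same]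
      simp
    have hcs := abs_real_inner_le_norm
      (transfer σ N y Δ (Pi.single i (EuclideanSpace.single c (1 : ℝ))) i)
      (EuclideanSpace.single c (1 : ℝ) : V3)
    rw [hinner, hnorm_e, mul_one, abs_one] at hcs
    nlinarith [norm_nonneg (transfer σ N y Δ (Pi.single i (EuclideanSpace.single c (1 : ℝ))) i)]
  let g : Fin (N + 1) → Fin 3 → ℝ := fun k a =>
    ‖transfer σ N y Δ (Pi.single k (EuclideanSpace.single a (1 : ℝ))) i‖ ^ 2
  have hg : ∀ k a, 0 ≤ g k a := fun k a => sq_nonneg _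
  have hrow : 1 ≤ ∑ a : Fin 3, g i a :=
    calc (1 : ℝ) ≤ g i c := hentry
      _ ≤ ∑ a : Fin 3, g i a := Finset.single_le_sum (fun a _ => hg i a) (Finset.mem_univ c)
  have hsq : 1 ≤ (∑ a : Fin 3, g i a) ^ 2 := one_le_pow₀ hrow
  have hfin : (∑ a : Fin 3, g i a) ^ 2 ≤ ∑ k : Fin (N + 1), (∑ a : Fin 3, g k a) ^ 2 :=
    Finset.single_le_sum (f := fun k => (∑ a : Fin 3, g k a) ^ 2) (fun k _ => sq_nonneg _)
      (Finset.mem_univ i)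
  change 1 ≤ ∑ k : Fin (N + 1), (∑ a : Fin 3, g k a) ^ 2
  exact hsq.trans hfin

/-- **planar windows keep the mean participation `≥ 1`.** [folklore] -/
theorem one_le_ipr_of_planar {y : Cfg N} {Δ : ℝ} (c : Fin 3)
    (hP : ∀ k < colls σ N y Δ, ⟪normalAt σ N y k, (EuclideanSpace.single c (1 : ℝ) : V3)⟫_ℝ = 0) : 1 ≤ ipr σ N y Δ := by
  unfold ipr
  have hN : (0 : ℝ) < ((N + 1 : ℕ) : ℝ) := by positivity
  have hsum : ((N + 1 : ℕ) : ℝ) ≤ ∑ i : Fin (N + 1), rowIpr σ N y Δ i := by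
    have h1 : ∑ _i : Fin (N + 1), (1 : ℝ) = ((N + 1 : ℕ) : ℝ) := by
      rw [Finset.sum_const, Finset.card_univ, Fintype.card_fin, nsmul_eq_mul, mul_one]
    rw [← h1]
    exact Finset.sum_le_sum fun i _ => one_le_rowIpr_of_planar c hP i
  have hkey : ((N + 1 : ℕ) : ℝ)⁻¹ * ((N + 1 : ℕ) : ℝ) = 1 := inv_mul_cancel₀ hN.ne'
  calc (1 : ℝ) = ((N + 1 : ℕ) : ℝ)⁻¹ * ((N + 1 : ℕ) : ℝ) := hkey.symm
    _ ≤ ((N + 1 : ℕ) : ℝ)⁻¹ * ∑ i : Fin (N + 1), rowIpr σ N y Δ i :=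
        mul_le_mul_of_nonneg_left hsum (inv_nonneg.2 hN.le)

end Planar

end

end Summit.AtomisticToContinuum.HydrodynamicLimit.Theorems.DiffuseBackwardInfluenceNeg
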